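import Summits.NavierStokesRegularity.NavierStokesRegularity.Theses.RellichScar
import Summits.NavierStokesRegularity.NavierStokesRegularity.Theorems.RellichScarScarRigidityGeneratorHullReduction
import Summits.NavierStokesRegularity.NavierStokesRegularity.Theorems.RellichScarScarRigidityLinearRigidityReduction
import HarnessLib

/-!
# `ScarRigidity` — line `SketchIdeator6` (generator–hull), skeleton v3: the RESIDUAL
# (crux stmt-NavierStokesRegularity-11717, route RellichScar; lead a3)

Both routes of the line are landed sorry-free as conditional reductions:
`…Theorems/RellichScarScarRigidityGeneratorHullReduction.lean` (isolation route, p130786) and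
`…Theorems/RellichScarScarRigidityLinearRigidityReduction.lean` (linear route), on top of the seven landed platform stubs
(p129707 p129650 p130364 p129583 p131411 p131414 p131062) and the glue (p130597).  What is left is recorded here as TWO stubs:

* `stub_symmetricScarExists` — VERBATIM route item stmt-NavierStokesRegularity-11718 (sibling crux; DELEGATED, never worked here);
* `stub_isolationOrLinearRigidity` — the line's OPEN CORE, as a disjunction (prove EITHER):
  (S1) isolation of every singular smooth apex profile among its singular scar twins in the scale-invariant weighted sup-norm
  `sup (‖x‖+√(−t))³‖·‖/(−t)`, OR (LR) X-Liouville for the exact linearised Navier–Stokes system at a singular smooth apex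
  profile (no non-zero smooth divergence-free solution on the whole backward slab with finite weighted norm).
  Both are open-problem-sized (`Lines/SketchIdeator6_residual.md`); neither is a restatement of the crux (S1 is its
  small-difference form at a true profile; LR is linear).

`ScarRigidity_of` : by cases on the disjunction, through the two landed reductions.
-/

noncomputable section

open Set Filter Function MeasureTheory Metric TopologicalSpace
open scoped Topology ENNReal NNReal InnerProductSpace RealInnerProductSpace ContDiff Laplacian

set_option linter.dupNamespace false -- D-0017: `Summit.<S>.<S>.…` repeats the summit name by design

namespace Summit.NavierStokesRegularity.NavierStokesRegularity.Theorems.RellichScarScarRigidity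

open Literature.Analysis.FluidPDE
open Summit.NavierStokesRegularity.NavierStokesRegularity.Theses.RellichScar
open Summit.NavierStokesRegularity.NavierStokesRegularity.Theorems.ScarRigidity.Negative

/-- Physical space. -/
local notation "ℝ³" => EuclideanSpace ℝ (Fin 3)

/-! ## Registered stubs -/

/-- **STUB S0 (= route item stmt-NavierStokesRegularity-11718, DELEGATED).**  `SymmetricScarExists` verbatim. -/
theorem stub_symmetricScarExists : SymmetricScarExists := by
  sorry

/-- **STUB (OPEN core of the line): isolation OR linear rigidity at a true profile.**  Left disjunct (S1): every singular
smooth apex profile is isolated among its singular scar twins in the weighted sup-norm.  Right disjunct (LR): at a singular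
smooth apex profile, every jointly smooth divergence-free solution of the linearised Navier–Stokes system on the whole backward
slab with finite weighted norm vanishes.  Prove either. -/
theorem stub_isolationOrLinearRigidity :
    (∀ (V : ℝ → ℝ³ → ℝ³) (Q : ℝ → ℝ³ → ℝ) (C : ℝ), 0 < C →
      IsTypeIAncientMild C V → HasTypeIDecay C V → IsClassicalNSSolutionOn (Iio (0 : ℝ)) 1 0 V Q →
      ScaleInvariantBounds V Q → IsBackwardSingularPoint V 0 →
      ∃ ε : ℝ, 0 < ε ∧ ∀ (V' : ℝ → ℝ³ → ℝ³) (Q' : ℝ → ℝ³ → ℝ),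
        IsTypeIAncientMild C V' → HasTypeIDecay C V' → IsClassicalNSSolutionOn (Iio (0 : ℝ)) 1 0 V' Q' →
        ScaleInvariantBounds V' Q' → IsBackwardSingularPoint V' 0 → SameScar V' V →
        (∀ t < 0, ∀ x : ℝ³, ‖V' t x - V t x‖ ≤ ε * ((-t) / (‖x‖ + Real.sqrt (-t)) ^ 3)) →
        ∀ t < 0, ∀ x : ℝ³, V' t x = V t x) ∨
    (∀ (V : ℝ → ℝ³ → ℝ³) (Q : ℝ → ℝ³ → ℝ) (C : ℝ), 0 < C →
      IsTypeIAncientMild C V → HasTypeIDecay C V → IsClassicalNSSolutionOn (Iio (0 : ℝ)) 1 0 V Q →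
      ScaleInvariantBounds V Q → IsBackwardSingularPoint V 0 →
      ∀ (Z : ℝ → ℝ³ → ℝ³) (P : ℝ → ℝ³ → ℝ) (K : ℝ),
        IsSmoothSpaceTimeOn (Iio (0 : ℝ)) Z → IsSmoothSpaceTimeOn (Iio (0 : ℝ)) P →
        (∀ t < 0, VectorCalculus.IsDivFree (Z t)) →
        (∀ t < 0, ∀ x : ℝ³, deriv (fun s => Z s x) t + convect (V t) (Z t) x + convect (Z t) (V t) x =
            (Δ (Z t)) x - gradient (P t) x) →
        (∀ t < 0, ∀ x : ℝ³, ‖Z t x‖ ≤ K * ((-t) / (‖x‖ + Real.sqrt (-t)) ^ 3)) →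
        ∀ t < 0, ∀ x : ℝ³, Z t x = 0) := by
  sorry

/-! ## Composition -/

/-- **The crux from the two stubs**, through the landed reductions `scarRigidity_of_symmetricScarExists_of_isolation`
(isolation route) and `scarRigidity_of_symmetricScarExists_of_linearRigidity` (linear route). -/
theorem ScarRigidity_of : ScarRigidity := by
  rcases stub_isolationOrLinearRigidity with hS1 | hLR
  · exact scarRigidity_of_symmetricScarExists_of_isolation stub_symmetricScarExists hS1
  · exact scarRigidity_of_symmetricScarExists_of_linearRigidity stub_symmetricScarExists hLR

end Summit.NavierStokesRegularity.NavierStokesRegularity.Theorems.RellichScarScarRigidity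

end
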